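import Summits.HodgeConjecture.CorCM.Census.NondegenerateReduction

/-!
# Nondegenerate doubling: quasi-inverse certificates for arcs and for index-two doublings `A ⊔ xA` with `x² = c`

COR-CM (cell `pub-hodgecm2`), count-neutral kernel combinatorics by the binder seat b09 (gen 38; lane TWO-ADIC SPLITTING +
NONDEGENERATE REDUCTION, part F), sequel of part A `Census/NondegenerateReduction.lean` (`nondegenerate_of_cert`: a quasi-inverse certificate
`Σ_x t(x)·1_{T₀}(x⁻¹g) = 2^j·[g = 1] + w(g) + w(cg)` makes the base type `T₀` nondegenerate).  Theorems only: no definition, no `decide`, no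
certificate tables, no named fact, no `sorry`.
HONEST FRAMING: `HC_CM` is NOT proved, here or anywhere in the tree; nothing here is a period or a headline.

Two certificate constructions, for an ARBITRARY finite group `G` with a central involution `c` (the certificates are statements about a finite
subset `A ⊆ G` and integer functions `t, w` on `G`; `A` need not be a CM type):

* §1 **ARCS** (`cert_arc`).  For `u ∈ G` of order `2M` with `u^M = c`, the arc `A = {1, u, …, u^{M−1}}` has the two-term quasi-inverse `t = δ₁ − δ_u`:
  `Σ_x t(x)·1_A(x⁻¹g) = 1_A(g) − 1_A(u⁻¹g) = [g = 1] − [g = c] = 2·[g = 1] + w(g) + w(cg)` with `w = −δ₁`, `j = 1`.  (Group ring: `(1 − u)·Σ_{i<M} uⁱ = 1 − u^M = 1 − c ≡ 2 mod (1 + c)`.)  So the arc types of CYCLIC groups `ℤ/2M` (seat b23ʼs cyclic column) are nondegenerate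
  of Kubota `2`-exponent one per character.
* §2 **DOUBLING** (`cert_double`).  If `A` carries a certificate `(t, w, j)` and `x ∈ G` satisfies `x² = c` with `A`, `xA` disjoint, then `A ⊔ xA` carries
  the certificate `(t − t(·x⁻¹), −2^j δ₁, j + 1)`: in the group ring `t(1 − x)(1 + x)·Σ_{y∈A} y = t(1 − c)·Σ_{y ∈ A} y ≡ 2^{j+1}`.  Every DICYCLIC-TYPE
  index-two extension (`G = H ⊔ xH`, `x² = c`: the generalised quaternion groups `Q_{2^k} ⊃ ℤ/2^{k−1}`, `Dic(H, c)` for `c` a square in `H`, …) thus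
  inherits nondegenerate base types `T_H ⊔ x·T_H` from nondegenerate types `T_H` of `H` — while for `x² = 1` (dihedral-type) `1 + x` is a zero
  divisor and `T_H ⊔ xT_H` is DEGENERATE (numerics of this seat: every type of `D₄` is degenerate; the arcs × arcs type of `D₁₆` is degenerate).
* §3 **The standard type of a dicyclic-type group is nondegenerate** (`nondegenerate_arc_double`): `u` of order `2M`, `u^M = c`, `x² = c`, and a CM
  type `T₀` with `T₀ = {uⁱ} ⊔ {x uⁱ}` (`i < M`) `⟹ T₀` satisfies the nondegeneracy hypothesis of `Nondegenerate.two_pow_smul_mem_of_reduction` — the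
  first input of the quaternion / dicyclic-twist column (`HOME/pub-hodgecm2-b09/lean-g38/SPLITTING-METHOD.md` §WHAT IS LEFT (1)).

## References
* [Pohlmann1968] H. Pohlmann, Algebraic cycles on abelian varieties of complex multiplication type, Ann. of Math. 88 (1968), Thm 1.
-/

namespace Summit.HodgeConjecture.CorCM.Census.Nondegenerate

open Finset
open Summit.HodgeConjecture.CorCM.Prior.AllgGroup.RfwfAllgGroup
open Summit.HodgeConjecture.CorCM.Census.BlockParity
open Summit.HodgeConjecture.CorCM.Census.Coinvariant

noncomputable section

variable {G : Type*} [Group G] [Fintype G] [DecidableEq G] (c : G)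

/-! ## §1 Arcs -/

/-- A sum against `δ₁ − δ_u`. [folklore] -/
theorem sum_delta_sub_delta_mul (u : G) (F : G → ℤ) :
    ∑ x, ((if x = 1 then (1 : ℤ) else 0) - (if x = u then 1 else 0)) * F x = F 1 - F u := by
  simp only [sub_mul, Finset.sum_sub_distrib, ite_mul, one_mul, zero_mul, Finset.sum_ite_eq', mem_univ, if_true]

omit [Fintype G] in
/-- Membership in an arc `{uⁱ : i < M}`. [folklore] -/
theorem mem_arc_iff (u : G) (M : ℕ) (g : G) : g ∈ (range M).image (fun i => u ^ i) ↔ ∃ i, i < M ∧ u ^ i = g := by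
  simp only [mem_image, mem_range]

/-- **The arc certificate.**  `u` of order `2M`, `M ≥ 1`, `u^M = c`: the arc `A = {1, u, …, u^{M−1}}` satisfies
`1_A(g) − 1_A(u⁻¹g) = [g = 1] − [g = c]`, i.e. the quasi-inverse identity with `t = δ₁ − δ_u`, `w = −δ₁`, `j = 1`. [folklore] -/
theorem cert_arc (u : G) (M : ℕ) (hM : 1 ≤ M) (hu : orderOf u = 2 * M) (huc : u ^ M = c) (g : G) :
    ∑ x, ((if x = 1 then (1 : ℤ) else 0) - (if x = u then 1 else 0)) * indG ((range M).image (fun i => u ^ i)) (x⁻¹ * g) =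
      (if g = 1 then (2 : ℤ) ^ 1 else 0) + (if g = 1 then (-1 : ℤ) else 0) + (if c * g = 1 then (-1 : ℤ) else 0) := by
  rw [sum_delta_sub_delta_mul, inv_one, one_mul]
  -- powers `u^i`, `i ≤ 2M − 1`, are pairwise distinct
  have hinj : ∀ i i' : ℕ, i < 2 * M → i' < 2 * M → u ^ i = u ^ i' → i = i' := fun i i' hi hi' h =>
    pow_injOn_Iio_orderOf (by rw [Set.mem_Iio, hu]; exact hi) (by rw [Set.mem_Iio, hu]; exact hi') h
  have hcg : c * g = 1 ↔ g = u ^ M := by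
    rw [← huc]
    constructor
    · intro h
      have e : g = (u ^ M)⁻¹ := eq_inv_of_mul_eq_one_right h
      rw [e, inv_eq_iff_mul_eq_one, ← pow_add, ← two_mul, ← hu, pow_orderOf_eq_one]
    · rintro rfl
      rw [← pow_add, ← two_mul, ← hu, pow_orderOf_eq_one]
  -- the two memberships
  have memA : g ∈ (range M).image (fun i => u ^ i) ↔ ∃ i, i < M ∧ u ^ i = g := mem_arc_iff u M g
  have memA' : u⁻¹ * g ∈ (range M).image (fun i => u ^ i) ↔ ∃ i, 1 ≤ i ∧ i ≤ M ∧ u ^ i = g := by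
    rw [mem_arc_iff]
    constructor
    · rintro ⟨i, hi, h⟩
      refine ⟨i + 1, by omega, by omega, ?_⟩
      rw [pow_succ', h, mul_inv_cancel_left]
    · rintro ⟨i, hi1, hiM, h⟩
      refine ⟨i - 1, by omega, ?_⟩
      rw [← h, show u ^ i = u * u ^ (i - 1) from by rw [← pow_succ']; congr 1; omega, inv_mul_cancel_left]
  unfold indG
  -- case analysis on `g`
  by_cases h1 : g = 1
  · subst h1
    have hin : ∃ i, i < M ∧ u ^ i = (1 : G) := ⟨0, by omega, pow_zero u⟩
    have hout : ¬ ∃ i, 1 ≤ i ∧ i ≤ M ∧ u ^ i = (1 : G) := by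
      rintro ⟨i, hi1, hiM, h⟩
      have := hinj i 0 (by omega) (by omega) (by rw [h, pow_zero])
      omega
    have hM' : ¬ (1 : G) = u ^ M := fun h => by
      have := hinj 0 M (by omega) (by omega) (by rw [pow_zero]; exact h)
      omega
    rw [if_pos (memA.mpr hin), if_neg (fun h => hout (memA'.mp h)), if_pos rfl, if_pos rfl, if_neg (fun h => hM' (hcg.mp h))]
    norm_num
  · by_cases hM' : g = u ^ M
    · have hin' : ∃ i, 1 ≤ i ∧ i ≤ M ∧ u ^ i = g := ⟨M, hM, le_rfl, hM'.symm⟩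
      have hout : ¬ ∃ i, i < M ∧ u ^ i = g := by
        rintro ⟨i, hi, h⟩
        have := hinj i M (by omega) (by omega) (by rw [h, hM'])
        omega
      rw [if_neg (fun h => hout (memA.mp h)), if_pos (memA'.mpr hin'), if_neg h1, if_neg h1, if_pos (hcg.mpr hM')]
      norm_num
    · rw [if_neg h1, if_neg h1, if_neg (fun h => hM' (hcg.mp h)), add_zero, add_zero]
      by_cases hin : ∃ i, i < M ∧ u ^ i = g
      · obtain ⟨i, hi, h⟩ := hin
        have hi1 : 1 ≤ i := by
          by_contra h0
          have : i = 0 := by omega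
          subst this; rw [pow_zero] at h; exact h1 h.symm
        rw [if_pos (memA.mpr ⟨i, hi, h⟩), if_pos (memA'.mpr ⟨i, hi1, by omega, h⟩), sub_self]
      · have hout : ¬ ∃ i, 1 ≤ i ∧ i ≤ M ∧ u ^ i = g := by
          rintro ⟨i, hi1, hiM, h⟩
          rcases Nat.lt_or_ge i M with hlt | hge
          · exact hin ⟨i, hlt, h⟩
          · have : i = M := by omega
            subst this; exact hM' h.symm
        rw [if_neg (fun h => hin (memA.mp h)), if_neg (fun h => hout (memA'.mp h)), sub_self]

/-! ## §2 Doubling by `x` with `x² = c` -/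

omit [Fintype G] in
/-- The indicator of a left translate: `1_{xA}(z) = 1_A(x⁻¹z)`. [folklore] -/
theorem indG_image_mul_left (A : Finset G) (x z : G) : indG (A.image (fun a => x * a)) z = indG A (x⁻¹ * z) := by
  unfold indG
  have e : z ∈ A.image (fun a => x * a) ↔ x⁻¹ * z ∈ A := by
    rw [mem_image]
    constructor
    · rintro ⟨a, ha, rfl⟩; rwa [inv_mul_cancel_left]
    · intro h; exact ⟨x⁻¹ * z, h, by rw [mul_inv_cancel_left]⟩
  simp only [e]

omit [Group G] [Fintype G] in
/-- The indicator of a disjoint union. [folklore] -/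
theorem indG_union_of_disjoint {A B : Finset G} (h : Disjoint A B) (z : G) : indG (A ∪ B) z = indG A z + indG B z := by
  unfold indG
  by_cases hA : z ∈ A
  · have hB : z ∉ B := Finset.disjoint_left.mp h hA
    rw [if_pos (mem_union_left _ hA), if_pos hA, if_neg hB, add_zero]
  · by_cases hB : z ∈ B
    · rw [if_pos (mem_union_right _ hB), if_neg hA, if_pos hB, zero_add]
    · rw [if_neg (by rw [mem_union]; tauto), if_neg hA, if_neg hB, add_zero]

/-- **The doubling certificate.**  `c` central with `c² = 1`, `x² = c`, `A` and `xA` disjoint, and `A` carries the quasi-inverse certificate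
`(t, w, j)`.  Then `A ⊔ xA` carries `(t − t(·x⁻¹), −2^j δ₁, j + 1)`. [folklore] -/
theorem cert_double (hc2 : c * c = 1) (hcen : ∀ y : G, y * c = c * y) (A : Finset G) (x : G) (hx : x * x = c)
    (hdisj : Disjoint A (A.image (fun a => x * a))) (t w : G → ℤ) (j : ℕ)
    (hA : ∀ g : G, ∑ y, t y * indG A (y⁻¹ * g) = (if g = 1 then (2 : ℤ) ^ j else 0) + w g + w (c * g)) (g : G) :
    ∑ y, (t y - t (y * x⁻¹)) * indG (A ∪ A.image (fun a => x * a)) (y⁻¹ * g) =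
      (if g = 1 then (2 : ℤ) ^ (j + 1) else 0) + (if g = 1 then -(2 : ℤ) ^ j else 0) + (if c * g = 1 then -(2 : ℤ) ^ j else 0) := by
  have hcinv : c⁻¹ = c := inv_eq_of_mul_eq_one_right hc2
  -- the four pieces
  have e1 : ∀ y, (t y - t (y * x⁻¹)) * indG (A ∪ A.image (fun a => x * a)) (y⁻¹ * g) =
      t y * indG A (y⁻¹ * g) + t y * indG A ((y * x)⁻¹ * g) - t (y * x⁻¹) * indG A (y⁻¹ * g) -
        t (y * x⁻¹) * indG A ((y * x)⁻¹ * g) := by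
    intro y
    rw [indG_union_of_disjoint hdisj, indG_image_mul_left, show x⁻¹ * (y⁻¹ * g) = (y * x)⁻¹ * g by rw [mul_inv_rev, mul_assoc]]
    ring
  simp only [e1, Finset.sum_sub_distrib, Finset.sum_add_distrib]
  -- reindex: `Σ_y t(y) 1_A((yx)⁻¹ g) = Σ_y t(y x⁻¹) 1_A(y⁻¹ g)`
  have r1 : ∑ y, t y * indG A ((y * x)⁻¹ * g) = ∑ y, t (y * x⁻¹) * indG A (y⁻¹ * g) := by
    refine Fintype.sum_equiv (Equiv.mulRight x) _ _ fun y => ?_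
    simp only [Equiv.coe_mulRight, mul_inv_cancel_right]
  -- reindex: `Σ_y t(y x⁻¹) 1_A((yx)⁻¹ g) = Σ_y t(y) 1_A(y⁻¹ (c g))`
  have hxinv : x⁻¹ = x * c := inv_eq_of_mul_eq_one_right (by rw [← mul_assoc, hx, hc2])
  have r2 : ∑ y, t (y * x⁻¹) * indG A ((y * x)⁻¹ * g) = ∑ y, t y * indG A (y⁻¹ * (c * g)) := by
    refine Fintype.sum_equiv (Equiv.mulRight x⁻¹) _ _ fun y => ?_
    show t (y * x⁻¹) * indG A ((y * x)⁻¹ * g) = t (y * x⁻¹) * indG A ((y * x⁻¹)⁻¹ * (c * g))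
    congr 2
    rw [mul_inv_rev, mul_inv_rev, inv_inv, hxinv, mul_assoc x c y⁻¹, ← hcen y⁻¹, ← mul_assoc x y⁻¹ c, mul_assoc (x * y⁻¹) c g]
  rw [r1, r2, hA g, hA (c * g), ← mul_assoc, hc2, one_mul, add_sub_cancel_right]
  -- bookkeeping of the indicator terms
  by_cases h1 : g = 1
  · subst h1
    by_cases hc : c * (1 : G) = 1
    · simp only [hc, if_true]; ring
    · simp only [hc, if_true, if_false]; ring
  · by_cases hc : c * g = 1
    · simp only [h1, hc, if_true, if_false]; ring
    · simp only [h1, hc, if_false]; ring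

/-! ## §3 The standard type of a dicyclic-type group is nondegenerate -/

/-- **Arc doubled by `x` with `x² = c`**: the certificate `(δ₁ − δ_u − δ_x⁻¹... )` — explicitly, `A ⊔ xA` with `A = {uⁱ : i < M}`, `u` of order `2M`,
`u^M = c`, `x² = c`, `A ∩ xA = ∅`, carries a quasi-inverse certificate with `2`-exponent `2`. [folklore] -/
theorem cert_arc_double (hc2 : c * c = 1) (hcen : ∀ y : G, y * c = c * y) (u x : G) (M : ℕ) (hM : 1 ≤ M) (hu : orderOf u = 2 * M)
    (huc : u ^ M = c) (hx : x * x = c)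
    (hdisj : Disjoint ((range M).image (fun i => u ^ i)) (((range M).image (fun i => u ^ i)).image (fun a => x * a))) (g : G) :
    ∑ y, (((if y = 1 then (1 : ℤ) else 0) - (if y = u then 1 else 0)) -
        ((if y * x⁻¹ = 1 then (1 : ℤ) else 0) - (if y * x⁻¹ = u then 1 else 0))) *
      indG ((range M).image (fun i => u ^ i) ∪ ((range M).image (fun i => u ^ i)).image (fun a => x * a)) (y⁻¹ * g) =
      (if g = 1 then (2 : ℤ) ^ (1 + 1) else 0) + (if g = 1 then -(2 : ℤ) ^ 1 else 0) + (if c * g = 1 then -(2 : ℤ) ^ 1 else 0) :=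
  cert_double c hc2 hcen _ x hx hdisj (fun y => (if y = 1 then (1 : ℤ) else 0) - (if y = u then 1 else 0))
    (fun g => if g = 1 then (-1 : ℤ) else 0) 1
    (fun g => cert_arc c u M hM hu huc g) g

/-- **THE STANDARD TYPE OF A DICYCLIC-TYPE GROUP IS NONDEGENERATE.**  `c` central, `c² = 1`; `u` of order `2M ≥ 2` with `u^M = c`; `x² = c`;
a CM type `T₀ = {uⁱ : i < M} ⊔ {x uⁱ : i < M}` (disjointly).  Then `T₀` is nondegenerate in the sense of part A: every antisymmetric `f : G → ℤ`
killed by the convolution with `1_{T₀}` vanishes.  (E.g. `G = Q_{4M} = ⟨u, x⟩`, the generalised quaternion / dicyclic groups, `T₀` the standard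
type.) [folklore] -/
theorem nondegenerate_arc_double (hc2 : c * c = 1) (hcen : ∀ y : G, y * c = c * y) (u x : G) (M : ℕ) (hM : 1 ≤ M)
    (hu : orderOf u = 2 * M) (huc : u ^ M = c) (hx : x * x = c)
    (hdisj : Disjoint ((range M).image (fun i => u ^ i)) (((range M).image (fun i => u ^ i)).image (fun a => x * a)))
    (T₀ : CMF G c) (hT₀ : T₀.1 = (range M).image (fun i => u ^ i) ∪ ((range M).image (fun i => u ^ i)).image (fun a => x * a)) :
    ∀ f : G → ℤ, (∀ Q, f (c * Q) = -f Q) → (∀ y, ∑ Q, f Q * indG T₀.1 (y * Q) = 0) → ∀ Q, f Q = 0 := by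
  refine nondegenerate_of_cert c hc2 hcen T₀
    (fun y => ((if y = 1 then (1 : ℤ) else 0) - (if y = u then 1 else 0)) -
      ((if y * x⁻¹ = 1 then (1 : ℤ) else 0) - (if y * x⁻¹ = u then 1 else 0)))
    (fun g => if g = 1 then -(2 : ℤ) ^ 1 else 0) (1 + 1) fun g => ?_
  rw [hT₀]
  exact cert_arc_double c hc2 hcen u x M hM hu huc hx hdisj g

end

end Summit.HodgeConjecture.CorCM.Census.Nondegenerate
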